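/-
  Summits/AtomisticToContinuum/Crystallization/Theorems/OverbindingBudgetAffineFarQuarticCount.lean

  residual stmt-AtomisticToContinuum-31280 · slot Z `FarAggregatePricing 12 (1/25) (1/2000) (1/(2·10⁷))` · the L-slot's rank-2 UNDECIDED chart-free
  leaf FF `FarFieldShadowBound` (…FarRechartCoherence, p844337): THE CLEAR-RADIUS NORMAL FORM OF THE FAR FIELD and its potential-free core, the
  QUARTIC SITE COUNT (decomp-a2c lens-4 «minimal counterexample / extremal reduction», g52).
  Imports ONLY the tree file `…OverbindingBudgetAffineFarRechartShelter` (p844572).  0 sorry · 0 axiom · no instance · no notation · no option.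
-/
import Summits.AtomisticToContinuum.Crystallization.Theorems.OverbindingBudgetAffineFarRechartShelter

/-! # FF ⟸ SFB ⟸ DC — the far field priced by the CLEAR RADIUS; the quartic site count of defect-free almost-conformal matter

THESIS (g52).  Every far-field counterexample to FF reduces to a SHELTERED one, and a sheltered one to a DENSIFYING one.
(1) FF ⟸ SFB (`farFieldShadowBound_of_shelteredFarBound`, PROVED).  Let `m·nn_i` be the CLEAR RADIUS of the normal far row `i` (distance to the
nearest NON-GOOD site) and `M' := max M (L/ε₁)`, `L(δ) = 2¹⁴/(12δ⁹)` the window bound.  A defect within `M'·nn_i` gives the kernel floor `K ≥ M'⁻⁴`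
(`inv_pow_le_defectKernel_of_near`) against the whole class costing `≤ L` (`neg_smoothTail_le_window`): `A := L·M'⁴`.  No defect within `M'·nn_i`: the
far class inside the open clear ball is priced by SFB at `m ≥ M'` (open shelter by MINIMALITY of the nearest defect, or any radius if there is none),
the class beyond it by the packing tail lemma `neg_smoothTail_le_of_radius`: `L/m² ≤ L/M' ≤ ε₁`.  FF follows with `C₂ + 1`; the kernel is GONE.
(2) SFB ⟸ DC (`shelteredFarBound_of_quarticCount`, PROVED).  In an open-sheltered ball, `m ≥ max (2λ) (4λ²L/ε₁)`, split the far class at `m/(2λ)`: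
outside, the packing tail lemma at radius `m/(2λ)` costs `4λ²L/m² ≤ ε₁`; inside, `−tailW·V ≤ d⁻⁶/6` termwise, the normalised distances
`t = d/nn_i ≥ R_ε = (C₁ε₁)^{-1/2} ≥ 1` are dominated dyadically, `t⁻⁶ ≤ Σ_j (R_ε2ʲ)⁻⁶·1{t ≤ R_ε2ʲ⁺¹}` (`inv_pow_six_le_dyadic`), each dyadic ball is
counted by DC at radius `min (R_ε2ʲ⁺¹) (m/(2λ)) ∈ [1, m/λ]`: `≤ H(R_ε2ʲ⁺¹)⁴`; with `nn_i ≥ 0.95648` on NORMAL rows (`normal_nearestDist_lb`: not SHORT,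
or not BAD hence `RT`-separated; so `nn_i⁻⁶ ≤ 2`) the inside costs `≤ (1/12)·2·Σ_j 16H·R_ε⁻²·2⁻ʲ ≤ (16/3)H·C₁ε₁`: `C₂ := 6HC₁ + 1`.  Exponent FOUR is
critical: the count's `R_ε⁴2⁴ʲ` against the weight's `R_ε⁻⁶2⁻⁶ʲ` leaves exactly the summable `R_ε⁻²·4⁻ʲ = C₁ε₁·4⁻ʲ`.

THE PIECES
* SFB · `ShelteredFarBound θ θ₀` [NORMAL FORM of FF · kernel-free · formally STRONGER than FF (FF ⇏ SFB: FF's `A·K` absorbs any sheltered loss, SFB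
  has no `K`) · UNDECIDED · TRUE-type given DC · INSTRUMENTABLE]: R_aff ⇒ `∀ C₁ > 0 ∃ C₂ ≥ 0, ε_F > 0 ∀ ε₁ ≤ ε_F ∀ δ ∃ M ≥ 2 ∀ y ∀ i ∈ Far ∖ sb ∀ m ≥ M`:
  if every site within `m·nn_i` (open ball) is GOOD, every good class `S` in the far annulus `R_ε ≤ |y k − y i|/nn_i < m` has `−smoothTail S y i ≤ C₂ε₁`.
* DC · `ShelteredQuarticCount θ θ₀` [NEW LEAF · potential-free · chart-free · kernel-free · UNDECIDED · TRUE-type · INSTRUMENTABLE · ATTACKABLE-L]: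
  R_aff ⇒ `∃ H ≥ 1, λ ≥ 2, ε_D > 0 ∀ ε₁ ≤ ε_D ∀ δ ∀ y ∀ i ∈ Far ∖ sb ∀ m`: if every site within `m·nn_i` is good then for `1 ≤ r ≤ m/λ` the sites within
  `r·nn_i` of `y i` number `≤ H·r⁴` — the site density of defect-free `AffReg(ε₁, θ)` matter grows at most LINEARLY with the distance, seen from any
  of its normal rows, up to a fixed fraction of the clear radius.  WHY TRUE (paper): the two-shell frames of a defect-free ball develop into ONE map
  from a Barlow region onto the ball (the COMB/RIG content SM also uses, but only qualitatively — no `ε₁`-exact matching, no drift radius),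
  `(1+cε₁)`-affine at lattice scale with linear parts `θ`-close to similarities, i.e. a `K`-QUASICONFORMAL embedding, `K ≤ ((1+θ')/(1−θ'))² ≈ 1.12`
  (`θ' = θ/√2`); `K`-qc maps are locally `1/K`-Hölder with their inverses (Reshetnyak II.1.1) and locally quasisymmetric on `λ⁻¹`-sub-balls (Gehring,
  Väisälä), so the preimage of the `r·nn_i`-ball lies in a lattice ball of radius `≤ C·r^K` and the count is `≤ C'r^{3K} ≤ C'r^{3.4} ≤ Hr⁴` — margin 0.6
  in the exponent; Hölder-sharp example = the radial trumpet `|x|^{α−1}x`, `α = 1/K`, around a normal row (count `≍ r^{3K}`); Liouville (`θ = 0`, Möbius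
  blob): spacing `≥ nn_i/4` inside the half clear radius, count `≤ (8r+1)³`.  WHY IT MIGHT FAIL: only if the developed map of a sheltered ball can fold
  far below the clear radius without a non-good seam, or `λ = 2`-type sub-balls are too large for local quasisymmetry — whence `λ` is DC's to choose.
  WHY STRICTLY WEAKER than FF/SFB: no potential, no `smoothTail`, no `C₁`, no annulus — pure incidence geometry (p = 4 is the weakest count giving
  FF); than SM: no chart, no matching, no `Recharts`; and NOT implied by SM-chaining (charts chained over `m/R_ε` drift radii control `log nn` only
  Lipschitz-ly, `e^{cε₁d}`, never a power).  INSTRUMENT (census FUNNEL-COUNT): max over normal rows of `#{d ≤ r·nn_i}/r⁴`, `1 ≤ r ≤ m/2`, on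
  defect-free `AffReg(1/2000…1/25)` funnels — radial inverse-power trumpet around the row (the super-cubic family, `r^{3K}`), Möbius blob (cubic),
  volume-preserving twists/spirals (exactly cubic: controls); KILL = an unbounded ratio.  Degenerate instances: `Far ∖ sb = ∅` / `N ≤ 1` vacuous;
  `r = 1` needs `H ≥ 13`; `H, λ` before `ε₁, δ` (scale-free: the `δ`-packing bound `(4r/δ+1)³` does NOT prove DC, nor does the Lipschitz bound).
RECORDS: `farFieldShadowBound_of_quarticCount : DC → FF`; `sitewiseRechartLoss_of_quartic_sheltered : DC → SM → Z3k`; ★ slot Z from seven leaves,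
FF ↦ DC: `farAggregatePricing_record_of_leaves_quartic : Z2 → Zr‴a → Zr‴b → Z3a → DC → SM → Z4″ → FarAggregatePricing 12 (1/25) (1/2000) (1/(2·10⁷))`;
FF stays as the coarse alternative (v10 record `farAggregatePricing_record_of_leaves_sheltered`).
WHY NOVEL (vs v5–v10, g51): the first FAR-FIELD normal form — g51's clear radius priced the NEAR field below the drift radius against SM; here the same
extremal quantity removes the kernel from the far field (`A·K` is spent once, on the window bound), and what is left of the L-slot's undecided content
is a statement of pure incidence geometry, the discrete LIOUVILLE RIGIDITY of almost-conformal close packings, which no earlier piece (Z3b…Z3k, FF,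
SC, IC, NF, SM) isolated: each of them carries the potential, a chart, or the kernel.  HIDDEN-GAUGE AUDIT: no chart anywhere (R_aff kept as the
lineage's standing premise so DC ≤ FF in shape); `C₂, ε_F | H, λ, ε_D` before `ε₁, δ`, `M` after both (it uses `L(δ)/ε₁`) — FF's discipline for `A`.
-/

namespace Summit.AtomisticToContinuum.Crystallization.Theorems.OverbindingBudgetAffineFarSmoothSplit

open scoped BigOperators Classical
open Literature.MathematicalPhysics.StatisticalMechanics
open Literature.Geometry.DiscreteGeometry (nearestDist nearestDist_nonneg nearestDist_le_dist le_nearestDist nearestDist_def IsChargeFree)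
open Summit.AtomisticToContinuum.Crystallization.Theorems.OverbindingBudgetBalancedCensusStatements
open Summit.AtomisticToContinuum.Crystallization.Theorems.OverbindingBudgetAffineLadder
open Summit.AtomisticToContinuum.Crystallization.Theorems.OverbindingBudgetAffineLocalisation
open Summit.AtomisticToContinuum.Crystallization.Theorems.OverbindingBudgetMisfitCensusStatements (Bad Short Long)
open Summit.AtomisticToContinuum.Crystallization.Theorems.OverbindingBudgetViolatorDensityFloor (RT)

variable {N : ℕ}

/-! ## §1  Three arithmetic–geometric facts (PROVED) -/

/-- **Normal rows have unit scale**: a normal far row `i ∈ Far ∖ sb` has `nn_i ≥ (122/125)(1 − 1/50) = 0.95648` — it is good, hence `(1/100)`-charge-free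
(`AffDeepReg` at `i' = i`), and not `Bad ∧ (Short ∨ Long)`: either not SHORT (the bound itself) or not BAD, i.e. it passes `RT (122/125) 0`, whose
separation clause bounds every other distance from below. [this file] -/
theorem normal_nearestDist_lb {θ₀ ε₁ θ δ : ℝ} (hδ : 0 < δ) {y : Fin N → EuclideanSpace ℝ (Fin 3)} (hy : Function.Injective y)
    {i : Fin N} (hi : i ∈ farSet θ₀ 12 ε₁ θ δ y \ goodScaleBadSet 12 ε₁ θ δ y) :
    122 / 125 * (1 - 1 / 50) ≤ nearestDist y i := by
  obtain ⟨hiF, hisb⟩ := Finset.mem_sdiff.mp hi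
  have hiG : i ∈ goodSet 12 ε₁ θ δ y := farSet_subset_goodSet θ₀ 12 ε₁ θ δ y hiF
  have hG := hiG; unfold goodSet at hG; rw [Finset.mem_filter] at hG
  obtain ⟨-, hdeep, hwin⟩ := hG
  have hex : ∃ k : Fin N, k ≠ i := by
    by_contra h; push Not at h
    haveI : IsEmpty {k : Fin N // k ≠ i} := ⟨fun k => k.2 (h k.1)⟩
    have h0 : nearestDist y i = 0 := by rw [nearestDist_def]; exact Real.iInf_of_isEmpty _
    linarith [hwin.1]
  have hnot : ¬ (Bad (122 / 125) 0 y i ∧ (Short (122 / 125) 0 y i ∨ Long (122 / 125) 0 y i)) := fun hb =>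
    hisb (by unfold goodScaleBadSet; rw [Finset.mem_filter]; exact ⟨hiG, hb⟩)
  by_cases hS : Short (122 / 125) 0 y i
  · have hcf : IsChargeFree (1 / 100 : ℝ) y i :=
      (hdeep i (by rw [dist_self]; exact mul_nonneg (by norm_num) (nearestDist_nonneg y i))).1
    have hRT : RT (122 / 125) 0 (Set.range y) (y i) := by by_contra hRT; exact hnot ⟨⟨hcf, hRT⟩, Or.inl hS⟩
    exact le_nearestDist hex fun k hk => by linarith [(hRT.2.2 (y k) ⟨k, rfl⟩ fun h => hk (hy h)).1]
  · unfold Short at hS; push Not at hS; linarith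

/-- **Dyadic domination of one far-field term**: for `0 < R ≤ t ≤ R·2ᴶ⁺¹`, `t⁻⁶ ≤ Σ_{j ≤ J} (R·2ʲ)⁻⁶ · 1{t ≤ R·2ʲ⁺¹}` (the shell `R2ʲ < t ≤ R2ʲ⁺¹`,
or `j = 0` when `t ≤ 2R`, already pays; the pattern of `kernelTerm_le_dyadic`). [this file] -/
theorem inv_pow_six_le_dyadic {R t : ℝ} (hR : 0 < R) (hRt : R ≤ t) {J : ℕ} (htJ : t ≤ R * 2 ^ (J + 1)) :
    (t⁻¹) ^ 6 ≤ ∑ j ∈ Finset.range (J + 1), ((R * 2 ^ j)⁻¹) ^ 6 * (if t ≤ R * 2 ^ (j + 1) then (1 : ℝ) else 0) := by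
  have hnn : ∀ j ∈ Finset.range (J + 1), (0 : ℝ) ≤ ((R * 2 ^ j)⁻¹) ^ 6 * (if t ≤ R * 2 ^ (j + 1) then (1 : ℝ) else 0) :=
    fun j _ => by split_ifs <;> positivity
  have ht : 0 < t := lt_of_lt_of_le hR hRt
  by_cases h2 : t ≤ R * 2
  · refine le_trans ?_ (Finset.single_le_sum hnn (Finset.mem_range.mpr (Nat.succ_pos J)))
    rw [if_pos (by simpa using h2), mul_one, pow_zero, mul_one]
    exact pow_le_pow_left₀ (inv_nonneg.mpr ht.le) (inv_anti₀ hR hRt) 6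
  · have h2 : R * 2 < t := not_le.mp h2
    have hex : ∃ j : ℕ, t ≤ R * 2 ^ (j + 1) := ⟨J, htJ⟩
    have hj₀ : t ≤ R * 2 ^ (Nat.find hex + 1) := Nat.find_spec hex
    have hj₀J : Nat.find hex ≤ J := Nat.find_le htJ
    have hj₀pos : 0 < Nat.find hex := Nat.pos_of_ne_zero fun h => by rw [h] at hj₀; norm_num at hj₀; linarith
    have hlow : R * 2 ^ Nat.find hex < t := by
      have hmin := Nat.find_min hex (show Nat.find hex - 1 < Nat.find hex by omega)
      rw [show Nat.find hex - 1 + 1 = Nat.find hex by omega] at hmin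
      exact not_le.mp hmin
    have hmem : Nat.find hex ∈ Finset.range (J + 1) := Finset.mem_range.mpr (by omega)
    refine le_trans ?_ (Finset.single_le_sum hnn hmem)
    rw [if_pos hj₀, mul_one]
    exact pow_le_pow_left₀ (inv_nonneg.mpr ht.le) (inv_anti₀ (by positivity) hlow.le) 6

/-- The far-field sum of one row, termwise: `−smoothTail S ≤ (1/12)·Σ_{k∈S} |y i − y k|⁻⁶` when no `k ∈ S` sits at `y i`
(`neg_tailW_mul_lennardJones_le`). [this file] -/
theorem neg_smoothTail_le_sum_inv_pow_six {y : Fin N → EuclideanSpace ℝ (Fin 3)} {i : Fin N} {S : Finset (Fin N)}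
    (hS : ∀ k ∈ S, 0 < dist (y i) (y k)) : -smoothTail S y i ≤ 1 / 12 * ∑ k ∈ S, ((dist (y i) (y k))⁻¹) ^ 6 := by
  have hsum : -smoothTail S y i
      = 1 / 2 * ∑ k ∈ S, -(tailW (nearestDist y i) (dist (y i) (y k)) * lennardJones (dist (y i) (y k))) := by
    unfold smoothTail; rw [Finset.sum_neg_distrib]; ring
  rw [hsum]
  calc 1 / 2 * ∑ k ∈ S, -(tailW (nearestDist y i) (dist (y i) (y k)) * lennardJones (dist (y i) (y k)))
      ≤ 1 / 2 * ∑ k ∈ S, (1 / 6 * ((dist (y i) (y k))⁻¹) ^ 6) :=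
        mul_le_mul_of_nonneg_left (Finset.sum_le_sum fun k hk => neg_tailW_mul_lennardJones_le _ (hS k hk)) (by norm_num)
    _ = 1 / 12 * ∑ k ∈ S, ((dist (y i) (y k))⁻¹) ^ 6 := by rw [← Finset.mul_sum]; ring

/-! ## §2  The two pieces: the sheltered far bound (normal form) and the quartic count (the leaf) -/

/-- **SFB · `ShelteredFarBound θ θ₀`** (NORMAL FORM of FF · kernel-free · formally stronger than FF · UNDECIDED · TRUE-type given DC · INSTRUMENTABLE):
R_aff ⇒ `∀ C₁ > 0 ∃ C₂ ≥ 0, ε_F > 0 ∀ ε₁ ≤ ε_F ∀ δ ∈ (0,2] ∃ M ≥ 2` such that for every injective configuration, every normal far row `i ∈ Far ∖ sb`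
and every `m ≥ M`: if every site within `m·nn_i` of `y i` (open ball) is GOOD, then every good class `S` all of whose sites lie in the far annulus
`1 ≤ C₁ε₁(|y i − y k|/nn_i)²`, `|y i − y k| < m·nn_i` has `−smoothTail S y i ≤ C₂·ε₁`.  (FF ⟸ SFB and SFB ⟸ DC proved below.) -/
def ShelteredFarBound (θ θ₀ : ℝ) : Prop :=
  AffineChartStraightening → ∀ C₁ : ℝ, 0 < C₁ → ∃ C₂ εF : ℝ, 0 ≤ C₂ ∧ 0 < εF ∧
    ∀ ε₁ : ℝ, 0 < ε₁ → ε₁ ≤ εF → ∀ δ : ℝ, 0 < δ → δ ≤ 2 → ∃ M : ℝ, 2 ≤ M ∧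
      ∀ (N : ℕ) (y : Fin N → EuclideanSpace ℝ (Fin 3)), Function.Injective y →
        ∀ i ∈ farSet θ₀ 12 ε₁ θ δ y \ goodScaleBadSet 12 ε₁ θ δ y, ∀ m : ℝ, M ≤ m →
          (∀ k : Fin N, dist (y k) (y i) < m * nearestDist y i → k ∈ goodSet 12 ε₁ θ δ y) →
            ∀ S : Finset (Fin N), S ⊆ goodSet 12 ε₁ θ δ y →
              (∀ k ∈ S, 1 ≤ C₁ * ε₁ * (dist (y i) (y k) / nearestDist y i) ^ 2 ∧ dist (y i) (y k) < m * nearestDist y i) →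
                -smoothTail S y i ≤ C₂ * ε₁

/-- **DC · `ShelteredQuarticCount θ θ₀`** (NEW LEAF · potential-free · chart-free · kernel-free · UNDECIDED · TRUE-type (quasiconformal local quasisymmetry,
exponent `3K ≈ 3.4 < 4`) · INSTRUMENTABLE (FUNNEL-COUNT) · ATTACKABLE-L): R_aff ⇒ `∃ H ≥ 1, λ ≥ 2, ε_D > 0 ∀ ε₁ ≤ ε_D ∀ δ ∈ (0,2]` such that for every
injective configuration, every normal far row `i ∈ Far ∖ sb` and every `m`: if every site within `m·nn_i` of `y i` (open ball) is GOOD, then for every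
`r` with `1 ≤ r` and `λ·r ≤ m` the sites within `r·nn_i` of `y i` number `≤ H·r⁴`.  Why it might fail: a defect-free almost-conformal funnel whose
developed map folds without a non-good seam, or an inverse-power funnel steeper than quartic (excluded on paper: exponent `3K ≈ 3.4 < 4`). -/
def ShelteredQuarticCount (θ θ₀ : ℝ) : Prop :=
  AffineChartStraightening → ∃ H lam εD : ℝ, 1 ≤ H ∧ 2 ≤ lam ∧ 0 < εD ∧
    ∀ ε₁ : ℝ, 0 < ε₁ → ε₁ ≤ εD → ∀ δ : ℝ, 0 < δ → δ ≤ 2 →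
      ∀ (N : ℕ) (y : Fin N → EuclideanSpace ℝ (Fin 3)), Function.Injective y →
        ∀ i ∈ farSet θ₀ 12 ε₁ θ δ y \ goodScaleBadSet 12 ε₁ θ δ y, ∀ m : ℝ,
          (∀ k : Fin N, dist (y k) (y i) < m * nearestDist y i → k ∈ goodSet 12 ε₁ θ δ y) →
            ∀ r : ℝ, 1 ≤ r → lam * r ≤ m →
              ((Finset.univ.filter fun k : Fin N => dist (y k) (y i) ≤ r * nearestDist y i).card : ℝ) ≤ H * r ^ 4

/-! ## §3  FF ⟸ SFB — the clear-radius dichotomy (PROVED) -/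

/-- ★ **`ShelteredFarBound ⇒ FarFieldShadowBound`** — `C₂ + 1`, `M' := max M (L/ε₁)`, `A := L·M'⁴`: a defect within `M'·nn_i` is paid by the
kernel floor against the window bound; else the far class inside the (open) clear ball is sheltered-priced and the class beyond it costs
`L/m² ≤ L/M' ≤ ε₁` by the packing tail lemma. [this file] -/
theorem farFieldShadowBound_of_shelteredFarBound {θ θ₀ : ℝ} (h : ShelteredFarBound θ θ₀) : FarFieldShadowBound θ θ₀ := by
  intro hR C₁ hC₁
  obtain ⟨C₂, εF, hC₂, hεF, hSFB⟩ := h hR C₁ hC₁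
  refine ⟨C₂ + 1, εF, by positivity, hεF, fun ε₁ hε₁ hε₁F δ hδ hδ2 => ?_⟩
  obtain ⟨M, hM2, hM⟩ := hSFB ε₁ hε₁ hε₁F δ hδ hδ2
  set L : ℝ := 2 ^ 14 / (12 * δ ^ 9) with hL
  have hL0 : 0 < L := by positivity
  set M' : ℝ := max M (L / ε₁) with hM'
  have hMM' : M ≤ M' := le_max_left _ _
  have hM'1 : 1 ≤ M' := by linarith
  have hM'0 : 0 < M' := by linarith
  have hLM' : L / M' ^ 2 ≤ ε₁ := by
    have h2 : L ≤ M' * ε₁ := by have h1 : L / ε₁ ≤ M' := le_max_right _ _; rwa [div_le_iff₀ hε₁] at h1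
    calc L / M' ^ 2 ≤ L / M' := div_le_div_of_nonneg_left hL0.le hM'0 (by rw [sq]; exact le_mul_of_one_le_right hM'0.le hM'1)
      _ ≤ ε₁ := by rw [div_le_iff₀ hM'0]; linarith
  refine ⟨L * M' ^ 4, by positivity, fun N y hy i hi S hSG hSfar => ?_⟩
  have hiG : i ∈ goodSet 12 ε₁ θ δ y := farSet_subset_goodSet θ₀ 12 ε₁ θ δ y (Finset.mem_sdiff.mp hi).1
  have hnn : 0 < nearestDist y i := lt_of_lt_of_le hδ (inWindow_of_mem_goodSet hiG).1
  have hAK : 0 ≤ L * M' ^ 4 * defectKernel 12 ε₁ θ δ y i := mul_nonneg (by positivity) (defectKernel_nonneg 12 ε₁ θ δ y i)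
  have hW : -smoothTail S y i ≤ L := neg_smoothTail_le_window hδ hδ2 hy hiG hSG
  by_cases hA : ∃ k : Fin N, k ∉ goodSet 12 ε₁ θ δ y ∧ dist (y k) (y i) < M' * nearestDist y i
  · -- case 1: a defect within `M'·nn_i` — kernel floor `K ≥ M'⁻⁴` against the window bound `L`
    obtain ⟨k, hkG, hkd⟩ := hA
    have hKf : 1 / M' ^ 4 ≤ defectKernel 12 ε₁ θ δ y i := inv_pow_le_defectKernel_of_near hiG hkG hδ hM'0 hkd.le
    have he : L * M' ^ 4 * (1 / M' ^ 4) = L := by field_simp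
    have h1 := mul_le_mul_of_nonneg_left hKf (show (0 : ℝ) ≤ L * M' ^ 4 by positivity)
    have h2 : 0 ≤ (C₂ + 1) * ε₁ := by positivity
    linarith
  · push Not at hA
    by_cases hB : ∀ k : Fin N, k ∈ goodSet 12 ε₁ θ δ y
    · -- case 2: no defect at all — open-sheltered at every radius; take `m` beyond the whole class
      set T : ℝ := ∑ k ∈ S, dist (y i) (y k) / nearestDist y i with hT
      have hSin : ∀ k ∈ S, 1 ≤ C₁ * ε₁ * (dist (y i) (y k) / nearestDist y i) ^ 2 ∧
          dist (y i) (y k) < max M (T + 1) * nearestDist y i := fun k hk => ⟨hSfar k hk, by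
        have h1 : dist (y i) (y k) / nearestDist y i ≤ T :=
          Finset.single_le_sum (f := fun k => dist (y i) (y k) / nearestDist y i) (fun k _ => by positivity) hk
        rw [← div_lt_iff₀ hnn]; linarith [le_max_right M (T + 1)]⟩
      have h := hM N y hy i hi (max M (T + 1)) (le_max_left _ _) (fun k _ => hB k) S hSG hSin
      linarith [hε₁.le]
    · -- case 3: the nearest defect `k` at `m·nn_i`, `m ≥ M'` — SFB inside the open clear ball, the packing tail beyond it
      push Not at hB
      obtain ⟨k₀, hk₀⟩ := hB
      obtain ⟨k, hkc, hkmin⟩ := Finset.exists_min_image (goodSet 12 ε₁ θ δ y)ᶜ (fun k => dist (y k) (y i)) ⟨k₀, Finset.mem_compl.mpr hk₀⟩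
      have hkG : k ∉ goodSet 12 ε₁ θ δ y := Finset.mem_compl.mp hkc
      set m : ℝ := dist (y k) (y i) / nearestDist y i with hm
      have hmnn : m * nearestDist y i = dist (y k) (y i) := by rw [hm]; exact div_mul_cancel₀ _ hnn.ne'
      have hM'm : M' ≤ m := by rw [hm, le_div_iff₀ hnn]; exact hA k hkG
      have hshel : ∀ k' : Fin N, dist (y k') (y i) < m * nearestDist y i → k' ∈ goodSet 12 ε₁ θ δ y := by
        intro k' hk'
        by_contra hk'G
        have h1 : dist (y k) (y i) ≤ dist (y k') (y i) := hkmin k' (Finset.mem_compl.mpr hk'G)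
        rw [hmnn] at hk'
        linarith
      set S₁ : Finset (Fin N) := S.filter fun k' => dist (y i) (y k') < m * nearestDist y i with hS₁
      have hS₁S : S₁ ⊆ S := Finset.filter_subset _ _
      have hin : -smoothTail S₁ y i ≤ C₂ * ε₁ :=
        hM N y hy i hi m (hMM'.trans hM'm) hshel S₁ (hS₁S.trans hSG) fun k' hk' => by
          rw [Finset.mem_filter] at hk'
          exact ⟨hSfar k' hk'.1, hk'.2⟩
      have hout : -smoothTail (S \ S₁) y i ≤ L / m ^ 2 :=
        neg_smoothTail_le_of_radius hδ hδ2 hy hiG (Finset.sdiff_subset.trans hSG) (hM'1.trans hM'm) fun k' hk' => by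
          rw [Finset.mem_sdiff, Finset.mem_filter] at hk'
          by_contra hcon
          exact hk'.2 ⟨hk'.1, not_le.mp hcon⟩
      have hm2 : L / m ^ 2 ≤ ε₁ :=
        (div_le_div_of_nonneg_left hL0.le (by positivity) (pow_le_pow_left₀ hM'0.le hM'm 2)).trans hLM'
      rw [smoothTail_eq_add_sdiff hS₁S y i, neg_add]
      linarith

/-! ## §4  SFB ⟸ DC — the dyadic count (PROVED) -/

/-- ★ **`ShelteredQuarticCount ⇒ ShelteredFarBound`** — `C₂ := 6HC₁ + 1`, `ε_F := min ε_D C₁⁻¹` (so `R_ε ≥ 1`), `M := max (2λ) (4λ²L/ε₁)`: beyond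
`(m/(2λ))·nn_i` the packing tail lemma (`4λ²L/m² ≤ ε₁`); inside, `d⁻⁶ ≤ 2·t⁻⁶` (`nn_i ≥ 0.95648`), the dyadic domination `inv_pow_six_le_dyadic` from
`t ≥ R_ε`, each dyadic ball counted by DC at radius `min (R_ε2ʲ⁺¹) (m/(2λ))`, and `(1/12)·2·Σ_j 16H·R_ε⁻²·2⁻ʲ ≤ (16/3)H·C₁ε₁`. [this file] -/
theorem shelteredFarBound_of_quarticCount {θ θ₀ : ℝ} (h : ShelteredQuarticCount θ θ₀) : ShelteredFarBound θ θ₀ := by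
  intro hR C₁ hC₁
  obtain ⟨H, lam, εD, hH, hlam, hεD, hDC⟩ := h hR
  refine ⟨6 * H * C₁ + 1, min εD (1 / C₁), by positivity, lt_min hεD (by positivity), fun ε₁ hε₁ hε₁F δ hδ hδ2 => ?_⟩
  have hε₁D : ε₁ ≤ εD := hε₁F.trans (min_le_left _ _)
  have hCε1 : C₁ * ε₁ ≤ 1 := by have h1 := (le_div_iff₀ hC₁).mp (hε₁F.trans (min_le_right _ _)); linarith
  have hCε : 0 < C₁ * ε₁ := mul_pos hC₁ hε₁
  have hlam0 : 0 < lam := by linarith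
  have hH0 : 0 ≤ H := by linarith
  set L : ℝ := 2 ^ 14 / (12 * δ ^ 9) with hL
  have hL0 : 0 < L := by positivity
  refine ⟨max (2 * lam) (4 * lam ^ 2 * L / ε₁), le_trans (by linarith) (le_max_left _ _), fun N y hy i hi m hMm hshel S hSG hS => ?_⟩
  have h2lm : 2 * lam ≤ m := le_trans (le_max_left _ _) hMm
  have hm0 : 0 < m := by linarith
  have hiG : i ∈ goodSet 12 ε₁ θ δ y := farSet_subset_goodSet θ₀ 12 ε₁ θ δ y (Finset.mem_sdiff.mp hi).1
  have hnn : 0 < nearestDist y i := lt_of_lt_of_le hδ (inWindow_of_mem_goodSet hiG).1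
  have hnn0 : nearestDist y i ≠ 0 := hnn.ne'
  have hnn9 : 9 / 10 ≤ nearestDist y i := le_trans (by norm_num) (normal_nearestDist_lb hδ hy hi)
  -- the far radius `R = (C₁ε₁)^{-1/2} ≥ 1`
  set R : ℝ := (Real.sqrt (C₁ * ε₁))⁻¹ with hRdef
  have hR0 : 0 < R := inv_pos.mpr (Real.sqrt_pos.mpr hCε)
  have hR2 : R ^ 2 * (C₁ * ε₁) = 1 := by rw [hRdef, inv_pow, Real.sq_sqrt hCε.le]; field_simp
  have hR1 : 1 ≤ R := by
    by_contra hlt; push Not at hlt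
    linarith [mul_lt_mul_of_pos_right (mul_self_lt_mul_self hR0.le hlt) hCε]
  have hRC : 1 / R ^ 2 = C₁ * ε₁ := by rw [eq_comm, eq_div_iff (pow_pos hR0 2).ne']; linarith
  -- normalised distances `t_k ≥ R`, so no `k ∈ S` sits at `y i`
  have ht : ∀ k ∈ S, R ≤ dist (y i) (y k) / nearestDist y i := fun k hk => by
    have ht0 : 0 ≤ dist (y i) (y k) / nearestDist y i := by positivity
    by_contra hlt; push Not at hlt
    linarith [mul_lt_mul_of_pos_left (mul_self_lt_mul_self ht0 hlt) hCε, (hS k hk).1]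
  have hSpos : ∀ k ∈ S, 0 < dist (y i) (y k) := fun k hk => by
    have h3 := mul_pos (lt_of_lt_of_le hR0 (ht k hk)) hnn
    rwa [div_mul_cancel₀ _ hnn0] at h3
  -- split `S` at radius `(m/(2λ))·nn_i`; the OUTER part by the packing tail lemma
  set S₁ : Finset (Fin N) := S.filter fun k => 2 * lam * dist (y i) (y k) ≤ m * nearestDist y i with hS₁
  have hS₁S : S₁ ⊆ S := Finset.filter_subset _ _
  have hr1 : 1 ≤ m / (2 * lam) := by rw [le_div_iff₀ (by positivity)]; linarith
  have hout : -smoothTail (S \ S₁) y i ≤ L / (m / (2 * lam)) ^ 2 :=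
    neg_smoothTail_le_of_radius hδ hδ2 hy hiG (Finset.sdiff_subset.trans hSG) hr1 fun k hk => by
      rw [Finset.mem_sdiff, Finset.mem_filter] at hk
      have h1 : ¬ (2 * lam * dist (y i) (y k) ≤ m * nearestDist y i) := fun h => hk.2 ⟨hk.1, h⟩
      rw [div_mul_eq_mul_div, div_le_iff₀ (by positivity)]
      linarith [not_le.mp h1]
  have hout' : L / (m / (2 * lam)) ^ 2 ≤ ε₁ := by
    have h1 := (div_le_iff₀ hε₁).mp (le_trans (le_max_right _ _) hMm)
    have h4 : m ≤ m ^ 2 := by rw [sq]; exact le_mul_of_one_le_right hm0.le (by linarith)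
    rw [show L / (m / (2 * lam)) ^ 2 = 4 * lam ^ 2 * L / m ^ 2 by field_simp; ring, div_le_iff₀ (by positivity)]
    linarith [mul_le_mul_of_nonneg_right h4 hε₁.le]
  -- the INNER part: a dyadic ceiling, termwise domination, the count
  obtain ⟨J, hJ⟩ : ∃ J : ℕ, ∀ k ∈ S₁, dist (y i) (y k) / nearestDist y i ≤ R * 2 ^ (J + 1) := by
    obtain ⟨n, hn⟩ := pow_unbounded_of_one_lt ((∑ k ∈ S, dist (y i) (y k) / nearestDist y i) / R) (by norm_num : (1 : ℝ) < 2)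
    refine ⟨n, fun k hk => ?_⟩
    have h1 : dist (y i) (y k) / nearestDist y i ≤ ∑ k ∈ S, dist (y i) (y k) / nearestDist y i :=
      Finset.single_le_sum (f := fun k => dist (y i) (y k) / nearestDist y i) (fun k _ => by positivity) (hS₁S hk)
    have h2 := (div_lt_iff₀ hR0).mp hn
    rw [pow_succ]; linarith [mul_pos (pow_pos (show (0 : ℝ) < 2 by norm_num) n) hR0]
  have hnn6 : ((nearestDist y i)⁻¹) ^ 6 ≤ 2 :=
    calc ((nearestDist y i)⁻¹) ^ 6 ≤ ((9 / 10 : ℝ)⁻¹) ^ 6 := pow_le_pow_left₀ (inv_nonneg.mpr hnn.le) (inv_anti₀ (by norm_num) hnn9) 6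
      _ ≤ 2 := by norm_num
  have hdom : ∀ k ∈ S₁, ((dist (y i) (y k))⁻¹) ^ 6 ≤ 2 * ∑ j ∈ Finset.range (J + 1),
      ((R * 2 ^ j)⁻¹) ^ 6 * (if dist (y i) (y k) / nearestDist y i ≤ R * 2 ^ (j + 1) then (1 : ℝ) else 0) := by
    intro k hk
    have hd0 : dist (y i) (y k) ≠ 0 := (hSpos k (hS₁S hk)).ne'
    have heq : ((dist (y i) (y k))⁻¹) ^ 6 = ((nearestDist y i)⁻¹) ^ 6 * ((dist (y i) (y k) / nearestDist y i)⁻¹) ^ 6 := by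
      rw [← mul_pow]; congr 1; rw [inv_div]; field_simp
    rw [heq]
    calc ((nearestDist y i)⁻¹) ^ 6 * ((dist (y i) (y k) / nearestDist y i)⁻¹) ^ 6
        ≤ 2 * ((dist (y i) (y k) / nearestDist y i)⁻¹) ^ 6 := mul_le_mul_of_nonneg_right hnn6 (by positivity)
      _ ≤ _ := mul_le_mul_of_nonneg_left (inv_pow_six_le_dyadic hR0 (ht k (hS₁S hk)) (hJ k hk)) (by norm_num)
  have hshell : ∀ j ∈ Finset.range (J + 1),
      ((R * 2 ^ j)⁻¹) ^ 6 * (((S₁.filter fun k => dist (y i) (y k) / nearestDist y i ≤ R * 2 ^ (j + 1)).card : ℕ) : ℝ)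
        ≤ 16 * H / R ^ 2 * (1 / 2 : ℝ) ^ j := by
    intro j _
    have hRj : 1 ≤ R * 2 ^ (j + 1) := one_le_mul_of_one_le_of_one_le hR1 (one_le_pow₀ (by norm_num))
    obtain ⟨r, hr⟩ : ∃ r : ℝ, r = min (R * 2 ^ (j + 1)) (m / (2 * lam)) := ⟨_, rfl⟩
    have hr1' : 1 ≤ r := by rw [hr]; exact le_min hRj hr1
    have hrm : lam * r ≤ m := by
      have h1 : r ≤ m / (2 * lam) := by rw [hr]; exact min_le_right _ _
      rw [le_div_iff₀ (by positivity)] at h1; linarith [mul_nonneg hlam0.le (show (0 : ℝ) ≤ r by linarith)]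
    have hsub : (S₁.filter fun k => dist (y i) (y k) / nearestDist y i ≤ R * 2 ^ (j + 1)) ⊆
        (Finset.univ.filter fun k : Fin N => dist (y k) (y i) ≤ r * nearestDist y i) := by
      intro k hk
      obtain ⟨hk1, hk2⟩ := Finset.mem_filter.mp hk
      rw [hS₁, Finset.mem_filter] at hk1
      refine Finset.mem_filter.mpr ⟨Finset.mem_univ _, ?_⟩
      rw [dist_comm]
      rcases le_total (R * 2 ^ (j + 1)) (m / (2 * lam)) with hle | hle
      · rw [hr, min_eq_left hle]; rwa [div_le_iff₀ hnn] at hk2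
      · rw [hr, min_eq_right hle, div_mul_eq_mul_div, le_div_iff₀ (by positivity)]; linarith [hk1.2]
    have hcard : (((S₁.filter fun k => dist (y i) (y k) / nearestDist y i ≤ R * 2 ^ (j + 1)).card : ℕ) : ℝ) ≤ H * r ^ 4 :=
      le_trans (by exact_mod_cast Finset.card_le_card hsub) (hDC ε₁ hε₁ hε₁D δ hδ hδ2 N y hy i hi m hshel r hr1' hrm)
    have hr4 : r ^ 4 ≤ (R * 2 ^ (j + 1)) ^ 4 := pow_le_pow_left₀ (by linarith) (by rw [hr]; exact min_le_left _ _) 4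
    have h12 : 1 / ((2 : ℝ) ^ j) ^ 2 ≤ (1 / 2 : ℝ) ^ j := by
      have hT1 : (1 : ℝ) ≤ 2 ^ j := one_le_pow₀ (by norm_num)
      rw [one_div_pow]
      exact div_le_div_of_nonneg_left (by norm_num) (by positivity) (by rw [sq]; exact le_mul_of_one_le_right (by positivity) hT1)
    calc ((R * 2 ^ j)⁻¹) ^ 6 * (((S₁.filter fun k => dist (y i) (y k) / nearestDist y i ≤ R * 2 ^ (j + 1)).card : ℕ) : ℝ)
        ≤ ((R * 2 ^ j)⁻¹) ^ 6 * (H * (R * 2 ^ (j + 1)) ^ 4) :=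
          mul_le_mul_of_nonneg_left (hcard.trans (mul_le_mul_of_nonneg_left hr4 hH0)) (by positivity)
      _ = 16 * H / R ^ 2 * (1 / ((2 : ℝ) ^ j) ^ 2) := by rw [pow_succ]; field_simp; ring
      _ ≤ 16 * H / R ^ 2 * (1 / 2 : ℝ) ^ j := mul_le_mul_of_nonneg_left h12 (by positivity)
  have hin : -smoothTail S₁ y i ≤ 6 * H * C₁ * ε₁ := by
    have hswap : ∑ k ∈ S₁, ((dist (y i) (y k))⁻¹) ^ 6 ≤ 2 * ∑ j ∈ Finset.range (J + 1),
        ((R * 2 ^ j)⁻¹) ^ 6 * (((S₁.filter fun k => dist (y i) (y k) / nearestDist y i ≤ R * 2 ^ (j + 1)).card : ℕ) : ℝ) :=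
      calc ∑ k ∈ S₁, ((dist (y i) (y k))⁻¹) ^ 6
          ≤ ∑ k ∈ S₁, 2 * ∑ j ∈ Finset.range (J + 1),
              ((R * 2 ^ j)⁻¹) ^ 6 * (if dist (y i) (y k) / nearestDist y i ≤ R * 2 ^ (j + 1) then (1 : ℝ) else 0) :=
            Finset.sum_le_sum hdom
        _ = 2 * ∑ j ∈ Finset.range (J + 1), ((R * 2 ^ j)⁻¹) ^ 6 *
              (((S₁.filter fun k => dist (y i) (y k) / nearestDist y i ≤ R * 2 ^ (j + 1)).card : ℕ) : ℝ) := by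
            rw [← Finset.mul_sum, Finset.sum_comm]
            congr 1
            refine Finset.sum_congr rfl fun j _ => ?_
            rw [← Finset.mul_sum, Finset.sum_boole]
    have hHR : H / R ^ 2 = H * (C₁ * ε₁) := by rw [div_eq_mul_one_div, hRC]
    calc -smoothTail S₁ y i ≤ 1 / 12 * ∑ k ∈ S₁, ((dist (y i) (y k))⁻¹) ^ 6 :=
          neg_smoothTail_le_sum_inv_pow_six fun k hk => hSpos k (hS₁S hk)
      _ ≤ 1 / 12 * (2 * ∑ j ∈ Finset.range (J + 1), 16 * H / R ^ 2 * (1 / 2 : ℝ) ^ j) :=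
          mul_le_mul_of_nonneg_left (hswap.trans (mul_le_mul_of_nonneg_left (Finset.sum_le_sum hshell) (by norm_num))) (by norm_num)
      _ = 8 / 3 * (H / R ^ 2) * ∑ j ∈ Finset.range (J + 1), (1 / 2 : ℝ) ^ j := by rw [← Finset.mul_sum]; ring
      _ ≤ 8 / 3 * (H / R ^ 2) * 2 := mul_le_mul_of_nonneg_left (sum_geometric_two_le _) (by positivity)
      _ = 16 / 3 * H * (C₁ * ε₁) := by rw [hHR]; ring
      _ ≤ 6 * H * C₁ * ε₁ := by linarith [mul_nonneg hH0 hCε.le]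
  rw [smoothTail_eq_add_sdiff hS₁S y i, neg_add]
  calc -smoothTail S₁ y i + -smoothTail (S \ S₁) y i ≤ 6 * H * C₁ * ε₁ + ε₁ := add_le_add hin (hout.trans hout')
    _ = (6 * H * C₁ + 1) * ε₁ := by ring

/-! ## §5  Records: FF from DC; Z3k from DC ∧ SM; slot Z from seven leaves with FF ↦ DC -/

/-- **`ShelteredQuarticCount ⇒ FarFieldShadowBound`** (composition of §4 and §3). [this file] -/
theorem farFieldShadowBound_of_quarticCount {θ θ₀ : ℝ} (h : ShelteredQuarticCount θ θ₀) : FarFieldShadowBound θ θ₀ :=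
  farFieldShadowBound_of_shelteredFarBound (shelteredFarBound_of_quarticCount h)

/-- ★ **`ShelteredQuarticCount ∧ ShelteredMatching ⇒ SitewiseRechartLoss`** (Z3k by name; Shelter §4 with FF from DC). [this file] -/
theorem sitewiseRechartLoss_of_quartic_sheltered {θ θ₀ : ℝ} (hQ : ShelteredQuarticCount θ θ₀) (hS : ShelteredMatching θ θ₀) :
    SitewiseRechartLoss θ θ₀ :=
  sitewiseRechartLoss_of_far_sheltered (farFieldShadowBound_of_quarticCount hQ) hS

/-- ★ **SLOT Z FROM SEVEN LEAVES, the far field as a COUNT: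
`FarCoreExcess ∧ ShelteredFarCharting ∧ NormalCorePricing ∧ TailDriftBound ∧ ShelteredQuarticCount ∧ ShelteredMatching ∧ ScaleBadFloor ⇒
FarAggregatePricing 12 (1/25) (1/2000) (1/(2·10⁷))`** — the landed record `farAggregatePricing_record_of_leaves_sheltered` with FF from DC. [this file] -/
theorem farAggregatePricing_record_of_leaves_quartic
    (h2 : FarCoreExcess (1 / 25) (1 / 2000) (1 / (2 * 10 ^ 7)))
    (hra : ShelteredFarCharting (1 / 25) (1 / 2000)) (hrb : NormalCorePricing (1 / 25))
    (h3a : TailDriftBound (1 / 25) (1 / 2000)) (hQ : ShelteredQuarticCount (1 / 25) (1 / 2000))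
    (hS : ShelteredMatching (1 / 25) (1 / 2000)) (h4 : ScaleBadFloor (1 / 25) (1 / (2 * 10 ^ 7))) :
    FarAggregatePricing 12 (1 / 25) (1 / 2000) (1 / (2 * 10 ^ 7)) :=
  farAggregatePricing_record_of_leaves_sheltered h2 hra hrb h3a (farFieldShadowBound_of_quarticCount hQ) hS h4

end Summit.AtomisticToContinuum.Crystallization.Theorems.OverbindingBudgetAffineFarSmoothSplit
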